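import Summits.CriticalPhenomena.CardyFormulaZ2.Theorems.CardyWhiteToColouredSimilarityUpgradeStubPolyominoHeartSuffices
import Summits.CriticalPhenomena.CardyFormulaZ2.Theorems.CardyWhiteToColouredSimilarityUpgradeStubBoxLimitStrictAnti
import Literature.Probability.Percolation.BoxCrossingJordan

/-!
# Stub `stub_scalingFnRegular` (line `registered`, crux `SimilarityUpgrade`, stmt-CriticalPhenomena-4597)

Crux `Summit.CriticalPhenomena.CardyFormulaZ2.Theses.CardyWhiteToColoured.SimilarityUpgrade`,
route `CardyWhiteToColoured`, sub-problem `CardyFormulaZ2`, line `registered`, c5 goal stub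
`stub_scalingFnRegular`: a documentary consequence of the crux conclusion `X_U`
(`∃ f, ∀ R, R.HasCrossingLimit (bondDomainCrossingProb R) f`) for the sibling crux
`CardyRigidity` (stmt-CriticalPhenomena-0746, "any such `f` is Cardy's function").  It is the
*soft half* of rigidity: the scaling function `f` of a conformally invariant bond-`ℤ²` crossing
limit is continuous, strictly increasing and `(0,1)`-valued on `(0,1)`.

Proof.  From `h : ∀ R, R.HasCrossingLimit (bondDomainCrossingProb R) f` and one uniformizing datum
`(ψ R, y R)` per conformal rectangle (`MarkedDomain.exists_isUniformizing_holds`) we get full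
limits `Φ R := f (crossRatio (y R))`.
* `polyominoHeart_exists_modulusFn Φ` (G4 of lead cycle c4) supplies the corner-marked box family
  `Qc w = ((0,w) × (0,1); i, 0, w, w + i)` and a function `g`, continuous on `(0,1)`, with: every
  `t ∈ (0,1)` is the modulus of some `Qc w` and `g t = Φ (Qc w)`; but then
  `Φ (Qc w) = f (crossRatio (y (Qc w))) = f t`, so `f = g` on `(0,1)` and `f` is continuous there.
* The modulus of `Qc w` is `η w` for the strictly antitone modulus function `η` of
  `rectangle_crossRatio_eq_of_aspectRatio_holds`; so for `t₁ < t₂` with boxes `Qc w₁`, `Qc w₂`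
  of these moduli, `η w₁ < η w₂` forces `w₂ < w₁`, and `stub_boxLimitStrictAnti` (the box crossing
  limit is strictly decreasing in the aspect ratio: RSW + sub-multiplicativity) gives
  `f t₁ = Φ (Qc w₁) < Φ (Qc w₂) = f t₂`.
* `f t = Φ (Qc w)` is the limit along the non-trivial filter `𝓝[>] 0` of
  `bondDomainCrossingProb (Qc w)`, hence a cluster point, hence in `(0,1)` by the RSW corollary
  `discreteCrossingProb_clusterPt_mem_Ioo_holds`.
No definitions are introduced.

References: B. Bollobás, O. Riordan, *Percolation* (2006), Ch. 7 §7.1 p. 184 (modulus strictly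
decreasing in the aspect ratio), Ch. 3 Lemma 1 and Corollary 3 (RSW); G. Grimmett, *Percolation*,
2nd ed. (1999), §11.7 Thm (11.70); J. Cardy, J. Phys. A 25 (1992) L201.
-/

noncomputable section

namespace Summit.CriticalPhenomena.CardyFormulaZ2.Cruxes.SimilarityUpgrade.Stubs

open Filter Topology Set MeasureTheory
open Literature.Probability.RandomPlanarGeometry
open Literature.Probability.Percolation

/-- **stub_scalingFnRegular.** Every scaling function `f` of a conformally invariant bond-`ℤ²`
crossing limit (`∀ R, R.HasCrossingLimit (bondDomainCrossingProb R) f`) is continuous, strictly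
increasing and `(0,1)`-valued on `(0,1)`: on `(0,1)`, `f` is the box crossing limit
`t ↦ Φ (Qc (η⁻¹ t))` read along the corner-marked box family (`polyominoHeart_exists_modulusFn`,
continuous by `rectangleContinuity`), the box limit is strictly decreasing in the aspect ratio
(`stub_boxLimitStrictAnti`) while the modulus `η` is strictly decreasing too
(`rectangle_crossRatio_eq_of_aspectRatio_holds`), and every crossing limit lies in `(0,1)` by
RSW (`discreteCrossingProb_clusterPt_mem_Ioo_holds`).
[cite: BollobasRiordan2006, Ch. 7 §7.1 p. 184; Ch. 3 Lemma 1, Corollary 3] -/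
theorem stub_scalingFnRegular : ∀ f : ℝ → ℝ, (∀ R : ConformalRectangle, R.HasCrossingLimit (bondDomainCrossingProb R) f) → ContinuousOn f (Ioo (0 : ℝ) 1) ∧ StrictMonoOn f (Ioo (0 : ℝ) 1) ∧ MapsTo f (Ioo (0 : ℝ) 1) (Ioo (0 : ℝ) 1) := by
  intro f h
  -- one uniformizing datum per conformal rectangle: the full limits `Φ R := f (crossRatio (y R))`
  choose ψ y hψ using fun R : ConformalRectangle => MarkedDomain.exists_isUniformizing_holds R
  have hlim : ∀ R : ConformalRectangle,
      Tendsto (bondDomainCrossingProb R) (𝓝[>] (0 : ℝ)) (𝓝 (f (crossRatio (y R)))) :=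
    fun R => h R (ψ R) (y R) (hψ R)
  -- the corner-marked box family and the modulus function of `Φ` along it (G4)
  obtain ⟨Qc, g, hg, hQc, hval⟩ :=
    polyominoHeart_exists_modulusFn (fun R => f (crossRatio (y R))) hlim
  -- `f t = Φ (Qc w)` whenever `Qc w` has modulus `t`
  have hfQ : ∀ (t w : ℝ),
      (∀ (ψ' : ConformalEquiv UpperHalfPlane.upperHalfPlaneSet (Qc w).carrier) (y' : Fin 4 → ℝ),
        (Qc w).IsUniformizing ψ' y' → crossRatio y' = t) →
      f t = f (crossRatio (y (Qc w))) := by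
    intro t w hmod
    rw [hmod (ψ (Qc w)) (y (Qc w)) (hψ _)]
  -- the modulus of `Qc w` is `η w`, `η` strictly antitone
  obtain ⟨η, hanti, -, hmod⟩ := rectangle_crossRatio_eq_of_aspectRatio_holds
  have hQmod : ∀ w : ℝ, 0 < w → crossRatio (y (Qc w)) = η w := by
    intro w hw
    obtain ⟨hcar, -, -, p0, p1, p2, p3⟩ := hQc w hw
    have key := hmod (Qc w) w 1 hw one_pos hcar ⟨by rw [p0]; simp, p1, p2, by rw [p3]; simp⟩
      (ψ (Qc w)) (y (Qc w)) (hψ _)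
    rwa [div_one] at key
  -- the box crossing limit is strictly decreasing in the aspect ratio (W2-6)
  have hbox : StrictAntiOn (fun w => f (crossRatio (y (Qc w)))) (Ioi 0) :=
    stub_boxLimitStrictAnti (fun R => f (crossRatio (y R))) hlim Qc
      fun w hw => ⟨(hQc w hw).1, (hQc w hw).2.1, (hQc w hw).2.2.1⟩
  refine ⟨?_, ?_, ?_⟩
  · -- continuity: `f = g` on `(0,1)`
    refine hg.congr fun t ht => ?_
    obtain ⟨w, -, hgw, hmodw⟩ := hval t ht
    rw [hgw]
    exact hfQ t w hmodw
  · -- strict monotonicity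
    intro t₁ ht₁ t₂ ht₂ hlt
    obtain ⟨w₁, hw₁, -, hmod₁⟩ := hval t₁ ht₁
    obtain ⟨w₂, hw₂, -, hmod₂⟩ := hval t₂ ht₂
    have h₁ : η w₁ = t₁ := by rw [← hQmod w₁ hw₁, hmod₁ (ψ (Qc w₁)) (y (Qc w₁)) (hψ _)]
    have h₂ : η w₂ = t₂ := by rw [← hQmod w₂ hw₂, hmod₂ (ψ (Qc w₂)) (y (Qc w₂)) (hψ _)]
    have hw : w₂ < w₁ := (hanti.lt_iff_gt (mem_Ioi.2 hw₁) (mem_Ioi.2 hw₂)).1 (by rw [h₁, h₂]; exact hlt)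
    rw [hfQ t₁ w₁ hmod₁, hfQ t₂ w₂ hmod₂]
    exact hbox (mem_Ioi.2 hw₂) (mem_Ioi.2 hw₁) hw
  · -- values in `(0,1)` (RSW)
    intro t ht
    obtain ⟨w, -, -, hmodw⟩ := hval t ht
    rw [hfQ t w hmodw]
    exact discreteCrossingProb_clusterPt_mem_Ioo_holds (Qc w) (hlim (Qc w)).mapClusterPt

end Summit.CriticalPhenomena.CardyFormulaZ2.Cruxes.SimilarityUpgrade.Stubs

end
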